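import Summits.BirchSwinnertonDyer.BirchSwinnertonDyer.Theorems.Rank2ObservatoryRank3ModThirtySevenImageA
import HarnessLib

/-!
# Rank-2 observatory, rank-3 arm — THE MOD-37 GALOIS IMAGE OF THE RANK-3 TABLE — PART B (chunk passes 10–18)

HONEST FRAMING: per-curve certified theorems and census instruments; no claim on BSD in rank ≥ 2.
Cell `b2b-bsdr2`, unit `b2b-bsdr2-cert-2` (rank-3 arm), gen 63 (KCI row 75, part B); zero-kit; `--supports stmt-BirchSwinnertonDyer-16218 --as helper`.
Nine more chunk passes `m37c10 … m37c18` of part A's row predicate `Rank3Row.m37Check` (`decide +kernel`, one pass `m37Go` per chunk of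
`352` rows: the repeated-eigenvalue certificate `Rank3Row.tv37B` at the row's witness prime `tv37At i`, or the row is on `cmIdx`).
Nothing is read off here; the assembly over all `27` chunks and the readings are in `…Rank3ModThirtySevenImage`.
FILE LAYOUT (KCI row 75 in three files, one kernel budget each): `…Rank3ModThirtySevenImageA` = the certificate Boolean `tv37B`, its
soundness, the witness data and the walk lemmas + chunk passes `01–09`; `…Rank3ModThirtySevenImageB` = chunk passes `10–18`;
`…Rank3ModThirtySevenImage` (the main file of this row) = chunk passes `19–27`, the assembly `m37Go_rank3Table` and the row-by-row readings.
NOT CLAIMED: anything beyond the nine Boolean facts.  Sources: as part A (Serre 1972 §2.4 Prop. 15; Mazur 1978 §6).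
-/

set_option linter.dupNamespace false
set_option autoImplicit false

namespace Summit.BirchSwinnertonDyer.BirchSwinnertonDyer.Rank2Observatory

section chunks
set_option maxHeartbeats 4000000
/-- chunk `10` (rows `3168 … 3519`) passes. [folklore] -/
theorem m37c10 : m37Go rank3Rows10 3168 = true := by decide +kernel
/-- chunk `11` (rows `3520 … 3871`) passes. [folklore] -/
theorem m37c11 : m37Go rank3Rows11 3520 = true := by decide +kernel
/-- chunk `12` (rows `3872 … 4223`) passes. [folklore] -/
theorem m37c12 : m37Go rank3Rows12 3872 = true := by decide +kernel
/-- chunk `13` (rows `4224 … 4575`) passes. [folklore] -/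
theorem m37c13 : m37Go rank3Rows13 4224 = true := by decide +kernel
/-- chunk `14` (rows `4576 … 4927`) passes. [folklore] -/
theorem m37c14 : m37Go rank3Rows14 4576 = true := by decide +kernel
/-- chunk `15` (rows `4928 … 5279`) passes. [folklore] -/
theorem m37c15 : m37Go rank3Rows15 4928 = true := by decide +kernel
/-- chunk `16` (rows `5280 … 5631`) passes. [folklore] -/
theorem m37c16 : m37Go rank3Rows16 5280 = true := by decide +kernel
/-- chunk `17` (rows `5632 … 5983`) passes. [folklore] -/
theorem m37c17 : m37Go rank3Rows17 5632 = true := by decide +kernel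
/-- chunk `18` (rows `5984 … 6335`) passes. [folklore] -/
theorem m37c18 : m37Go rank3Rows18 5984 = true := by decide +kernel
end chunks

end Summit.BirchSwinnertonDyer.BirchSwinnertonDyer.Rank2Observatory
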